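import Literature.Combinatorics.StablePolynomials.DiskInversion
import HarnessLib

/-!
# The inversion `I_κ` for the closed disc (Borcea–Brändén II, Corollary 1.7, `𝔻̄ ↔ ℂ ∖ 𝔻`)

J. Borcea, P. Brändén, *The Lee–Yang and Pólya–Schur programs. II.*, Comm. Pure Appl. Math. 62 (2009)
1595–1631 (arXiv:0809.3087), §1:

> **Corollary 1.7.** Let `κ ∈ ℕⁿ` and `I_κ : ℂ_κ[z] → ℂ_κ[z]` be the linear operator defined by
> `I_κ(z^α) = z^{κ-α}`, `α ≤ κ`. Then `I_κ` restricts to a bijection between the set of `𝔻`-stable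
> (`𝔻̄`-stable) polynomials in `ℂ_κ[z]` and the set of `ℂ ∖ 𝔻̄`-stable (`ℂ ∖ 𝔻`-stable) polynomials in `ℂ_κ[z]`
> of degree `κ`.

`DiskInversion.lean` has the open version (`𝔻 ↔ ℂ ∖ 𝔻̄`). This file adds the parenthetical closed version
(`𝔻̄`-stable: no zeros with all `|z_i| ≤ 1`; `ℂ ∖ 𝔻`-stable: no zeros with all `|z_i| ≥ 1`). The only new
ingredient is part I's Lemma 6.1 (leading coefficients) *up to the boundary*: if `f(z with z_j := v) ≠ 0` for
`z` in a set `T ⊇ Ω` (`Ω` open) and `|v| > 1`, then the leading coefficient in `z_j` does not vanish at the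
points of `T ∩ closure(Ω)` either (`eval_leadingSliceCoeff_ne_zero_of_mem_closure`: otherwise, by Hurwitz's
theorem along `𝓝[T] z₀`, it would vanish at nearby points of `Ω`, contradicting the open case) — "some zero of
a specialization of `f` would escape to infinity contradicting the boundedness of the zeros" [part I, proof of
Lemma 6.1].

## Main results (namespace `Literature.Combinatorics.StablePolynomials`)

* `eventually_eval_zero_of_zeroFree_punctured_of_le` (the Hurwitz step along a filter `l ≤ 𝓝 x₀`),
  **`eval_leadingSliceCoeff_ne_zero_of_mem_closure`**.
* `mem_closure_exteriorSet`, **`eval_cornerPoly_ne_zero_of_closedExterior`** (the corner coefficients `c_Z(q)`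
  of a `(ℂ ∖ 𝔻)ⁿ`-stable `q` have no zeros with `|u_j| ≥ 1`).
* `invOp_closedExteriorDiskStable`, `degVec_invOp_eq_of_closedDiskStable`, `invOp_closedDiskStable`,
  **`BorceaBranden_diskInversion_closed`** — Corollary 1.7, `𝔻̄ ↔ ℂ ∖ 𝔻`.

## References

* [BorceaBranden2009II] J. Borcea, P. Brändén, Comm. Pure Appl. Math. 62 (2009) 1595–1631, §1 Cor. 1.7.
* [BorceaBranden2009] J. Borcea, P. Brändén, Invent. Math. 177 (2009) 541–569, §6.1 Lemma 6.1.
-/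

noncomputable section

open MvPolynomial Finset Filter Metric Topology

namespace Literature.Combinatorics.StablePolynomials

variable {σ : Type*}

/-! ## §1 Leading coefficients up to the boundary -/

section Boundary

/-- **Hurwitz step along a filter.** As `eventually_eval_zero_of_zeroFree_punctured`, with the hypotheses and
the conclusion along any filter `l ≤ 𝓝 x₀` (e.g. `𝓝[T] x₀`). [cite: BorceaBranden2009, §1.2 Thm. 1.6
(Hurwitz' theorem) and §6.1 proof of Lemma 6.1] -/
theorem eventually_eval_zero_of_zeroFree_punctured_of_le {X : Type*} [UniformSpace X]
    [WeaklyLocallyCompactSpace X] (P : X → Polynomial ℂ)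
    (hcont : Continuous fun q : X × ℂ => (P q.1).eval q.2) {x₀ : X} {l : Filter X} (hl : l ≤ 𝓝 x₀)
    (hzero : ∀ᶠ x in l, ∀ τ : ℂ, τ ≠ 0 → ‖τ‖ < 1 → (P x).eval τ ≠ 0)
    (h0 : (P x₀).eval 0 = 0) (hne : P x₀ ≠ 0) :
    ∀ᶠ x in l, (P x).eval 0 = 0 := by
  obtain ⟨r, ⟨hr0, hr1⟩, hrS⟩ : ∃ r ∈ Set.Ioo (0 : ℝ) 1,
      r ∉ (P x₀).roots.toFinset.image (fun ρ => ‖ρ‖) :=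
    (Set.Ioo_infinite zero_lt_one).exists_notMem_finset _
  have hsphere : ∀ τ ∈ sphere (0 : ℂ) r, (P x₀).eval τ ≠ 0 := by
    intro τ hτ hτ0
    refine hrS (Finset.mem_image.2 ⟨τ, Multiset.mem_toFinset.2 ((Polynomial.mem_roots hne).2 hτ0), ?_⟩)
    exact mem_sphere_zero_iff_norm.1 hτ
  have hunif : TendstoUniformlyOn (fun x τ => (P x).eval τ) (fun τ => (P x₀).eval τ) (𝓝 x₀)
      (closedBall (0 : ℂ) r) := by
    haveI : CompactSpace (closedBall (0 : ℂ) r) :=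
      isCompact_iff_compactSpace.1 (isCompact_closedBall _ _)
    rw [tendstoUniformlyOn_iff_tendstoUniformly_comp_coe]
    exact Continuous.tendstoUniformly (fun x (τ : closedBall (0 : ℂ) r) => (P x).eval (τ : ℂ))
      (hcont.comp (continuous_fst.prodMk (continuous_subtype_val.comp continuous_snd))) x₀
  have hunif' : TendstoUniformlyOn (fun x τ => (P x).eval τ) (fun τ => (P x₀).eval τ) l
      (closedBall (0 : ℂ) r) := fun u hu => (hunif u hu).filter_mono hl
  have hF : ∀ᶠ x in l, DiffContOnCl ℂ (fun τ => (P x).eval τ) (ball (0 : ℂ) r) :=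
    Eventually.of_forall fun x => (P x).differentiable.diffContOnCl
  have hz := Complex.eventually_exists_zero_mem_ball_of_tendstoUniformlyOn hr0 hF hunif'
    (P x₀).continuous.continuousOn h0 hsphere
  filter_upwards [hz, hzero] with x hx hx'
  obtain ⟨τ, hτ, hτ0⟩ := hx
  by_cases hτ' : τ = 0
  · rwa [hτ'] at hτ0
  · exact absurd hτ0 (hx' τ hτ' ((mem_ball_zero_iff.1 hτ).trans hr1))

variable [Fintype σ]

/-- **Borcea–Brändén I, Lemma 6.1, leading coefficients up to the boundary.** Let `Ω ⊆ T ⊆ ℂ^σ` with `Ω`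
open, and suppose `f(z with z_j := v) ≠ 0` for all `z ∈ T` and `|v| > 1`. Then the leading coefficient of `f`
in `z_j` has no zero on `T ∩ closure(Ω)`. [cite: BorceaBranden2009, §6.1 Lemma 6.1 ("`γ` is the same for all
choices of `c_i ∈ C_i`"; circular domains open or closed)] -/
theorem eval_leadingSliceCoeff_ne_zero_of_mem_closure [DecidableEq σ] {f : MvPolynomial σ ℂ} {j : σ}
    {Ω T : Set (σ → ℂ)} (hΩ : IsOpen Ω) (hΩT : Ω ⊆ T)
    (hT : ∀ z ∈ T, ∀ v : ℂ, 1 < ‖v‖ → eval (Function.update z j v) f ≠ 0) {z₀ : σ → ℂ} (hz₀T : z₀ ∈ T)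
    (hz₀ : z₀ ∈ closure Ω) : eval z₀ (sliceCoeff f j (f.degreeOf j)) ≠ 0 := by
  intro h0
  have hzero : ∀ᶠ z in 𝓝[T] z₀, ∀ w : ℂ, w ≠ 0 → ‖w‖ < 1 → (sliceProbe f j z).eval w ≠ 0 :=
    eventually_nhdsWithin_of_forall fun z hz w hw0 hw1 => eval_sliceProbe_ne_zero (hT z hz) hw0 hw1
  have hP0 : (sliceProbe f j z₀).eval 0 = 0 := by rw [eval_zero_sliceProbe, h0]
  have hne : sliceProbe f j z₀ ≠ 0 := fun h => by
    have key := eval_sliceProbe_ne_zero (hT z₀ hz₀T) (w := 1 / 2) (by norm_num) (by norm_num)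
    rw [h, Polynomial.eval_zero] at key
    exact key rfl
  have hev := eventually_eval_zero_of_zeroFree_punctured_of_le (sliceProbe f j)
    (continuous_eval_sliceProbe f j) nhdsWithin_le_nhds hzero hP0 hne
  obtain ⟨U, hU, hUT⟩ := (eventually_nhdsWithin_iff.1 hev).exists_mem
  obtain ⟨z, hzU, hzΩ⟩ := mem_closure_iff_nhds.1 hz₀ U hU
  have hz0 : eval z (sliceCoeff f j (f.degreeOf j)) = 0 := by
    have := hUT z hzU (hΩT hzΩ)
    rwa [eval_zero_sliceProbe] at this
  exact eval_leadingSliceCoeff_ne_zero hΩ (fun z hz => hT z (hΩT hz)) hzΩ hz0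

end Boundary

/-! ## §2 Corner coefficients of a `(ℂ ∖ 𝔻)ⁿ`-stable polynomial -/

section Corner

variable [Fintype σ] [DecidableEq σ]

omit [DecidableEq σ] in
/-- A point with `|u_j| ≥ 1` (`j ∈ J`) is a limit of points with `|z_j| > 1` (`j ∈ J`): scale by `1 + δ`.
[cite: BorceaBranden2009, §6.1 (open and closed circular domains)] -/
theorem mem_closure_exteriorSet (J : Set σ) {u : σ → ℂ} (hu : ∀ j ∈ J, 1 ≤ ‖u j‖) :
    u ∈ closure {z : σ → ℂ | ∀ j ∈ J, 1 < ‖z j‖} := by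
  refine Metric.mem_closure_iff.2 fun ε hε => ?_
  set δ : ℝ := ε / (2 * (‖u‖ + 1)) with hδ
  have hu0 : 0 < ‖u‖ + 1 := by positivity
  have hδ0 : 0 < δ := by positivity
  refine ⟨fun j => (1 + (δ : ℂ)) * u j, fun j hj => ?_, ?_⟩
  · rw [norm_mul, show (1 + (δ : ℂ)) = ((1 + δ : ℝ) : ℂ) by push_cast; ring, Complex.norm_real,
      Real.norm_of_nonneg (by positivity)]
    calc (1 : ℝ) < 1 + δ := lt_add_of_pos_right 1 hδ0
      _ = (1 + δ) * 1 := (mul_one _).symm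
      _ ≤ (1 + δ) * ‖u j‖ := mul_le_mul_of_nonneg_left (hu j hj) (by positivity)
  · refine (dist_pi_lt_iff hε).2 fun j => ?_
    rw [dist_eq_norm, show u j - (1 + (δ : ℂ)) * u j = -((δ : ℂ) * u j) by ring, norm_neg, norm_mul,
      Complex.norm_real, Real.norm_of_nonneg hδ0.le]
    calc δ * ‖u j‖ ≤ δ * ‖u‖ := mul_le_mul_of_nonneg_left (norm_le_pi_norm u j) hδ0.le
      _ = ε * (‖u‖ / (2 * (‖u‖ + 1))) := by rw [hδ]; ring
      _ < ε * 1 := mul_lt_mul_of_pos_left (by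
          rw [div_lt_one (by positivity)]
          linarith [norm_nonneg u]) hε
      _ = ε := mul_one ε

/-- **The corner coefficients of a `(ℂ ∖ 𝔻)ⁿ`-stable polynomial have no zeros with `|u_j| ≥ 1`** (`j ∉ Z`):
the closed counterpart of `eval_cornerPoly_ne_zero`, by induction on `Z` through
`eval_leadingSliceCoeff_ne_zero_of_mem_closure`. [cite: BorceaBranden2009II, §1 Lemma 1.6 / Cor. 1.7
(closed version); BorceaBranden2009, §6.1 Lemma 6.1] -/
theorem eval_cornerPoly_ne_zero_of_closedExterior {q : MvPolynomial σ ℂ}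
    (hq : ∀ z : σ → ℂ, (∀ i, 1 ≤ ‖z i‖) → eval z q ≠ 0) (Z : Finset σ) {u : σ → ℂ}
    (hu : ∀ j, j ∉ Z → 1 ≤ ‖u j‖) : eval u (cornerPoly q Z) ≠ 0 := by
  have hq' : ∀ z : σ → ℂ, (∀ i, 1 < ‖z i‖) → eval z q ≠ 0 := fun z hz => hq z fun i => (hz i).le
  have hκ : degVec q ∈ q.support := degVec_mem_support_of_exteriorDiskStable hq'
  induction Z using Finset.induction_on generalizing u with
  | empty =>
    rw [cornerPoly_empty]
    exact hq u fun j => hu j (Finset.notMem_empty j)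
  | insert i Z hi ih =>
    rw [← sliceCoeff_cornerPoly q hi, ← degreeOf_cornerPoly hκ hi]
    have hopen : IsOpen {z : σ → ℂ | ∀ j ∈ ((↑(insert i Z) : Set σ)ᶜ), 1 < ‖z j‖} := by
      simp only [Set.setOf_forall]
      exact isOpen_iInter_of_finite fun j => isOpen_iInter_of_finite fun _ =>
        isOpen_lt continuous_const (continuous_apply j).norm
    refine eval_leadingSliceCoeff_ne_zero_of_mem_closure hopen
      (T := {z : σ → ℂ | ∀ j ∈ ((↑(insert i Z) : Set σ)ᶜ), 1 ≤ ‖z j‖})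
      (fun z hz j hj => (hz j hj).le) (fun z hz v hv => ih fun j hj => ?_)
      (fun j hj => hu j fun h => hj (Finset.mem_coe.2 h)) (mem_closure_exteriorSet _ fun j hj =>
        hu j fun h => hj (Finset.mem_coe.2 h))
    by_cases hji : j = i
    · subst hji
      rw [Function.update_self]
      exact hv.le
    · rw [Function.update_of_ne hji]
      exact hz j fun h => (Finset.mem_insert.1 (Finset.mem_coe.1 h)).elim hji hj

end Corner

/-! ## §3 Corollary 1.7, closed version -/

section Main

variable [Fintype σ] [DecidableEq σ]

omit [DecidableEq σ] in
/-- **`𝔻̄`-stable ⟹ `I_κ(p)` is `(ℂ ∖ 𝔻)`-stable** (`p ∈ ℂ_κ[z]`): for `|z_i| ≥ 1`, `I_κ(p)(z) = z^κ p(1/z) ≠ 0`.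
[cite: BorceaBranden2009II, §1 Cor. 1.7 (closed version)] -/
theorem invOp_closedExteriorDiskStable {κ : σ →₀ ℕ} {p : MvPolynomial σ ℂ} (hp : ∀ α ∈ p.support, α ≤ κ)
    (hst : ∀ z : σ → ℂ, (∀ i, ‖z i‖ ≤ 1) → eval z p ≠ 0) (z : σ → ℂ) (hz : ∀ i, 1 ≤ ‖z i‖) :
    eval z (invOp κ p) ≠ 0 := by
  have hz0 : ∀ i, z i ≠ 0 := fun i h => by
    have := hz i
    rw [h, norm_zero] at this
    exact absurd this (not_le.2 zero_lt_one)
  rw [eval_invOp hp hz0]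
  refine mul_ne_zero (Finset.prod_ne_zero_iff.2 fun i _ => pow_ne_zero _ (hz0 i)) (hst _ fun i => ?_)
  rw [norm_inv]
  exact inv_le_one_of_one_le₀ (hz i)

/-- `I_κ(p)` has degree exactly `κ` when `p ∈ ℂ_κ[z]` is `𝔻̄`-stable. [cite: BorceaBranden2009II, §1 Cor. 1.7
(closed version, "of degree `κ`")] -/
theorem degVec_invOp_eq_of_closedDiskStable {κ : σ →₀ ℕ} {p : MvPolynomial σ ℂ}
    (hp : ∀ α ∈ p.support, α ≤ κ) (hst : ∀ z : σ → ℂ, (∀ i, ‖z i‖ ≤ 1) → eval z p ≠ 0) :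
    degVec (invOp κ p) = κ :=
  degVec_invOp_eq hp fun z hz => hst z fun i => (hz i).le

/-- **`(ℂ ∖ 𝔻)`-stable of degree `κ` ⟹ `I_κ(q)` is `𝔻̄`-stable**: at a point of `𝔻̄ⁿ` with zero coordinates
`Z`, `I_κ(q)(z) = (Π_{j∉Z} z_j^{κ_j}) c_Z(q)(1/z) ≠ 0` by `eval_cornerPoly_ne_zero_of_closedExterior`.
[cite: BorceaBranden2009II, §1 Cor. 1.7 (closed version, with Lemma 1.6)] -/
theorem invOp_closedDiskStable {q : MvPolynomial σ ℂ}
    (hst : ∀ z : σ → ℂ, (∀ i, 1 ≤ ‖z i‖) → eval z q ≠ 0) (z : σ → ℂ) (hz : ∀ i, ‖z i‖ ≤ 1) :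
    eval z (invOp (degVec q) q) ≠ 0 := by
  rw [eval_invOp_eq_cornerPoly (fun α hα => le_degVec (mem_support_iff.1 hα)) z]
  refine mul_ne_zero (Finset.prod_ne_zero_iff.2 fun j hj => pow_ne_zero _ (Finset.mem_filter.1 hj).2)
    (eval_cornerPoly_ne_zero_of_closedExterior hst _ fun j hj => ?_)
  have hzj : z j ≠ 0 := fun h => hj (Finset.mem_filter.2 ⟨Finset.mem_univ j, h⟩)
  rw [norm_inv]
  exact (one_le_inv₀ (norm_pos_iff.2 hzj)).2 (hz j)

/-- **Borcea–Brändén II, Corollary 1.7, closed version** (`𝔻̄ ↔ ℂ ∖ 𝔻`). For `κ ∈ ℕⁿ` the involution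
`I_κ(z^α) = z^{κ-α}` of `ℂ_κ[z]` maps the `𝔻̄`-stable polynomials of `ℂ_κ[z]` to `(ℂ ∖ 𝔻)`-stable polynomials
of degree `κ`, and the `(ℂ ∖ 𝔻)`-stable polynomials of `ℂ_κ[z]` of degree `κ` to `𝔻̄`-stable polynomials.
[cite: BorceaBranden2009II, §1 Cor. 1.7] -/
theorem BorceaBranden_diskInversion_closed (κ : σ →₀ ℕ) :
    (∀ p : MvPolynomial σ ℂ, (∀ α ∈ p.support, α ≤ κ) → invOp κ (invOp κ p) = p) ∧
    (∀ p : MvPolynomial σ ℂ, (∀ α ∈ p.support, α ≤ κ) →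
      (∀ z : σ → ℂ, (∀ i, ‖z i‖ ≤ 1) → eval z p ≠ 0) →
        (∀ z : σ → ℂ, (∀ i, 1 ≤ ‖z i‖) → eval z (invOp κ p) ≠ 0) ∧ degVec (invOp κ p) = κ) ∧
    (∀ q : MvPolynomial σ ℂ, degVec q = κ →
      (∀ z : σ → ℂ, (∀ i, 1 ≤ ‖z i‖) → eval z q ≠ 0) →
        ∀ z : σ → ℂ, (∀ i, ‖z i‖ ≤ 1) → eval z (invOp κ q) ≠ 0) :=
  ⟨fun _ hp => invOp_invOp hp,
    fun _ hp hst => ⟨invOp_closedExteriorDiskStable hp hst, degVec_invOp_eq_of_closedDiskStable hp hst⟩,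
    fun q hκ hst z hz => by rw [← hκ]; exact invOp_closedDiskStable hst z hz⟩

end Main

end Literature.Combinatorics.StablePolynomials

end
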